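import Summits.Schanuel.Schanuel.Theorems.RootDecomp1BFactDischarge01

/-!
# RootDecomp1BTwoRadical — lens 4, generation 44, node 2 (g44b) «TWO-RADICAL DESCENT — t(1, ρ) = 5 AT THE RATIONAL COLUMN FOR EVERY ULTRA-LIOUVILLE ρ, HYPOTHESIS-FREE» (lanes B-R29 (ii) ∩ B-R30 (iv)/(d); CLAIM L2259, NODE L2268 / REQUEST L2269; critic VERDICT pending at staging — filed only on GO) — part 1 (RootDecomp1BTwoRadical01): §A2 formal algebra of two radicals

(lens-4 g44b HOME kernel K = HOME/decomp-schanuel-lens-4/g44b/TwoRadical.lean b925f14a…, 1327 l, imports tree `…RootDecomp1BFactDischarge01` ONLY; P/C per NODE.md. Port by census-1 gen 19 as `RootDecomp1BTwoRadical01`–`05` from the CENSUS CAP EDITION TwoRadical.capped.lean (census/tools/gen19/ports/tr/; = K with steps (2)–(5) of the kernel extracted as the public lemma `twoRadical_clash`, kernel statement BYTE-IDENTICAL, 53/53 decls identical + 1 new — same cut as TwoStorey's, RESHAPE RULE L1684): 01 = §A2 formal algebra of TWO radicals (`fiber_sum₂`, `powSubst₂`, `residue_lemma₂`, the q²×q²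 norm form `radMat₂`, `det_radMat₂_ne_zero`, `det_eq_eigen_mul₂`); 02 = §C2 the specialisation (`Cf₂`, `Frel₂`, sizes, Lipschitz, `eigen_eq_Frel₂` — TwoRadical's own versions, namespace-distinct from TwoStorey's); 03 = §D2 part 1: the private helper + the CLASH ENGINE `twoRadical_clash`; 04 = §D2 part 2: THE KERNEL `algebraicIndependent_twoRadical` (scoped `maxHeartbeats 1600000` as in K); 05 = §E2 cells mod `(hLW : LWMeasure)` + §F2 hypothesis-free via `lwMeasure_holds` (`five_le_polarDeg_one_ultra : ((5 : ℕ) : Cardinal) ≤ polarDeg ![(1:ℝ), ρ]` for EVERY ultra-Liouville ρ, `five_le_polarDeg_one_rhoU`, …) + §G2 the coordinate column at every storey (`polarDeg_snoc_ultra₂`, …).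
PORT EDITS: linter option dropped; one docstring added (`powSubst₂_apply`); §D2 re-cut for the 400-line cap (one new public lemma `twoRadical_clash`; eigenvector coordinates abstracted as `w` with `‖w c‖ ≤ Θ^q·Θ^q`, eigenvalue as `Φ`; thirteen now-unused local `have`s of the kernel dropped); every other statement and proof verbatim. `--supports stmt-Schanuel-24622`; no census credit carried; rung 0 — nothing here proves Schanuel.)
-/

/-!
# RootDecomp1B — lens-4 (minimal-counterexample / extremal reduction), generation 44, NODE 2 (g44b):
# TWO-RADICAL DESCENT — `t(1, ρ) = 5` AT THE RATIONAL COLUMN FOR EVERY ULTRA-LIOUVILLE `ρ`, HYPOTHESIS-FREE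

Cell `decomp-schanuel`, seat lens-4, CLAIM bus L2259 (RULE B-R29 (ii) «two-radical q²×q² norm form … i-direction» ∩
RULE B-R30 (iv) lane (d) «t(1,ρ) ≥ 5»). HOME-only Lean; nothing here is proposed to the tree by this seat (census ports).
RUNG 0 of the distance ledger is unchanged: NOTHING in this file proves `KleinPolarSchanuel` (item 24622), `KleinIH 3`,
or `Schanuel`; the route of record `RootDecomp1B` is untouched.

## What is proved (0 sorry · 0 new axioms · ONE scoped `set_option maxHeartbeats 1600000 in` on the kernel theorem,
## the tree precedent being `RootDecomp1BRadicalDescent04` l.27, same value, same proof skeleton)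

* §A2 FORMAL ALGEBRA (the ONE new piece of kernel work). `radMat₂ C K p hq i₀ i₁` — the `q² × q²` matrix (index
  `Fin q × Fin q`) of multiplication by `Σ_{k,k' ≤ K} C_{kk'} T^{pk} S^{pk'}` on `ℤ[X][T,S]/(T^q − X_{i₀}, S^q − X_{i₁})`
  in the basis `T^l S^{l'}`; `fiber_sum₂` (the double fibre sum = the eigenvector `(w^a w'^{a'})`); `residue_lemma₂`
  (a two-variable residue lemma: exponent PAIRS distinct mod `q`); `powSubst₂` = g30's `powSubst i₀ q ∘ powSubst i₁ q`;
  `det_radMat₂_ne_zero` — FORMAL NON-VANISHING of the two-radical norm form for `i₀ ≠ i₁`, `K < q`, `gcd(p,q) = 1`, some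
  `C_{kk'} ≠ 0`; `det_eq_eigen_mul₂` — `det M(θ) = Φ · Σ_c adj(M(θ))_{e(0,0),c} w^{a(c)} w'^{a'(c)}` on `Fin (q·q)`.
* §C2 SPECIALISATION. `Cf₂ P p q J (k,k') = q^J [U^k V^{k'}] P(U, V, p/q, X)`, sizes (`totalDegree_Cf₂_le`, `mvlen_Cf₂_le`,
  `mvlen_radMat₂_le`, `totalDegree_radMat₂_le`), `Frel₂ θ y₀ y₁ x = P(e^{x y₀}, e^{x y₁}, x, θ)` (`C¹`, local Lipschitz),
  `eigen_eq_Frel₂ : Σ_{k,k'} C_{kk'}(θ) s^{pk} s'^{pk'} = q^J · F(p/q)`.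
* §D2 KERNEL `algebraicIndependent_twoRadical {θ : Fin n → ℂ} (hθ : DExpMeasure θ) {i₀ i₁ : Fin n} (hne : i₀ ≠ i₁)
  {y₀ y₁ : ℂ} (hy₀ : cexp y₀ = θ i₀) (hy₁ : cexp y₁ = θ i₁) {ρ : ℝ} (hρ : UltraLiouville ρ) (hρ0 : 0 < ρ) :
  AlgebraicIndependent ℚ (Fin.cons (cexp (ρ * y₀)) (Fin.cons (cexp (ρ * y₁)) (Fin.cons (ρ : ℂ) θ)) : Fin (n + 3) → ℂ)`
  — g30's radical descent (tree `RootDecomp1BRadicalDescent01–04`, used BY NAME: `resFin`, `powSubst`, `QDiv`,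
  `qdiv_powSubst`, `powSubst_eq_zero_iff`, `DExpMeasure`, `UltraLiouville.exists_den_ge`, `exists_int_relation`,
  `norm_mvaeval_le_mvlen`, `totalDegree_det_le`, `mvlen_det_le`, `adjugate_bounds`, `kernel_clash_ineq`) run with TWO
  radicals `s = e^{y₀/q}`, `s' = e^{y₁/q}` at the same level `q`, the norm-form matrix transported to `Fin (q·q)` by
  `Matrix.reindex`, and g30's clash inequality applied VERBATIM at `q·q` in place of `q` (approximation order `2(A+1)`).
* §E2/§F2 CELLS. `algebraicIndependent_five_of_pos` (`(e^ρ, e^{iρ}, ρ, e, e^i)` a.i., `ρ > 0` ultra-Liouville; base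
  point `θ = exp(1, i)`, `DExpMeasure θ` from `dExpMeasure_exp_of_LW`); `five_le_polarDeg_of_ultra[_of_LW]` (general polar
  field containing `ρ, e, e^i, e^ρ, e^{iρ}` — the statement of `RootDecomp1BQuadFrame.five_le_polarDeg_of_quadHyper` with
  `UltraLiouville` for `QuadHyperLiouville` and NO `Roy2014_thm_1_1` binder); THE CELL
  `five_le_polarDeg_one_ultra {ρ : ℝ} (hρ : UltraLiouville ρ) : ((5 : ℕ) : Cardinal) ≤ polarDeg ![(1 : ℝ), ρ]`
  — UNCONDITIONAL (`LWMeasure` discharged by the tree theorem `RootDecomp1BFactDischarge.lwMeasure_holds`, Ably 1994);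
  `five_le_polarDeg_swap_ultra`, `five_le_polarDeg_one_rhoU` / `_swap_rhoU` (named member `ρ_U`, tree g33),
  `four_le_polarDeg_one_ultra'` (g33's X(2) floor as a corollary), `five_le_trdeg_polar_one_ultra` (`polarDeg` unfolded).
* §G2 THE COORDINATE COLUMN AT EVERY STOREY. `polarDeg_snoc_ultra₂ {m} {β : Fin m → ℝ} (hβ : ∀ j, IsAlgebraic ℚ (β j))
  (hli : LinearIndependent ℚ β) (j₀ : Fin m) (hρ : UltraLiouville ρ) :
  ((m + 1 + (m + 1) + 1 : ℕ) : Cardinal) ≤ polarDeg (Fin.snoc β (β j₀ * ρ))` — HYPOTHESIS-FREE, ONE ABOVE the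
  Klein–polar value `(m+1)+(m+1)` at the column `(β | β_{j₀} ρ)`; the tree's one-radical column
  `RootDecomp1BRadicalDescent.polarDeg_snoc_ultra (hLW) : ((m + 1 + (m + 1) : ℕ) : Cardinal) ≤ …` is recovered without
  its binder as `polarDeg_snoc_ultra'`; engine `polarDeg_snoc_of_pos₂` (base `θ = (e^β, e^{iβ})`, `i₀ ↔ e^{β_{j₀}}`,
  `i₁ ↔ e^{iβ_{j₀}}`).

## Position (tree, side by side)
* g30/g33 `RootDecomp1BRadicalDescent05.four_le_polarDeg_one_ultra (hLW)` / `RootDecomp1BFactDischarge01` (hyp-free):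
  `t(1, ρ) ≥ 4` for ultra-Liouville `ρ` — ONE radical `e^{1/q}`; the fifth element `e^{iρ}` was out of reach because
  `e^{iρ} ≈ (e^{i/q})^p` moves too. THIS FILE: `t(1, ρ) ≥ 5` = the full Schanuel value of the column, same class of `ρ`.
* `RootDecomp1BQuadFrame05.five_le_polarDeg_one_of_quadHyper (hRoy : Roy2014_thm_1_1) (hρ : QuadHyperLiouville ρ)`:
  `t(1, ρ) ≥ 5` CONDITIONAL on Roy's print fact, for a DIFFERENT (finite-exponent) class. THIS FILE: no print-fact binder.
* `RootDecomp1BHyperFrame05.not_linearIndependent_frame_one_rat`: the frame engine cannot reach the rational column.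
* `RootDecomp1BRadicalDescent05.polarDeg_snoc_ultra (hLW)`: the column `(β | β_{j₀} ρ)` at every storey, `t ≥ 2m + 2`.
  THIS FILE: `t ≥ 2m + 3` there, hypothesis-free.

## Honest scope
`UltraLiouville` is a dense `G_δ` of Lebesgue measure zero; `t(1, ρ) = 5` for ALL irrational `ρ` (let alone `KleinIH 3`,
`m ≥ 3`, or Schanuel) is NOT proved here, and the method (a measure at a FIXED L–W point + a Liouville specialisation)
does not extend to non-Liouville `ρ` — see the BARRIER notes in NODE.md. The upper bound `t(1, ρ) ≤ 5` (trivial count)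
is not formalised here.
-/

noncomputable section

open Complex

namespace Summit.Schanuel.Schanuel.Theorems.RootDecomp1BTwoRadical

/-! ## §A2 FORMAL ALGEBRA: the norm form of TWO radicals `T^q − X_{i₀}`, `S^q − X_{i₁}` over `ℤ[X]` -/

section Formal

open MvPolynomial
open RootDecomp1BRadicalDescent (resFin resFin_val fiber_sum powSubst psi psi_apply psi_apply_self powSubst_X
  powSubst_X_self powSubst_monomial powSubst_eq_sum powSubst_injective powSubst_eq_zero_iff QDiv qdiv_powSubst)

variable {n : ℕ}

/-- **Double fibre sum.** If `w^q = t` and `w'^q = t'` then the multiplication-by-`Σ_{k,k'} c_{kk'} T^{pk} S^{pk'}`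
matrix modulo `(T^q − t, S^q − t')` (row `(l,l')`, column `(a,a')`) has `(w^a w'^{a'})_{(a,a')}` as an eigenvector with
eigenvalue `Σ_{k,k'} c_{kk'} w^{pk} w'^{pk'}`. -/
theorem fiber_sum₂ {S : Type*} [CommSemiring S] {q : ℕ} (hq : 0 < q) (K p : ℕ) (c : ℕ × ℕ → S)
    (t t' w w' : S) (hw : w ^ q = t) (hw' : w' ^ q = t') (l l' : Fin q) :
    ∑ aa : Fin q × Fin q,
      (∑ kk ∈ (Finset.range (K + 1) ×ˢ Finset.range (K + 1)).filter
          (fun kk => (resFin hq (p * kk.1 + l), resFin hq (p * kk.2 + l')) = aa),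
        c kk * t ^ ((p * kk.1 + l) / q) * t' ^ ((p * kk.2 + l') / q)) * (w ^ (aa.1 : ℕ) * w' ^ (aa.2 : ℕ)) =
      (∑ kk ∈ Finset.range (K + 1) ×ˢ Finset.range (K + 1), c kk * (w ^ (p * kk.1) * w' ^ (p * kk.2))) *
        (w ^ (l : ℕ) * w' ^ (l' : ℕ)) := by
  have step1 : ∀ aa : Fin q × Fin q,
      (∑ kk ∈ (Finset.range (K + 1) ×ˢ Finset.range (K + 1)).filter
          (fun kk => (resFin hq (p * kk.1 + l), resFin hq (p * kk.2 + l')) = aa),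
        c kk * t ^ ((p * kk.1 + l) / q) * t' ^ ((p * kk.2 + l') / q)) * (w ^ (aa.1 : ℕ) * w' ^ (aa.2 : ℕ)) =
      ∑ kk ∈ (Finset.range (K + 1) ×ˢ Finset.range (K + 1)).filter
          (fun kk => (resFin hq (p * kk.1 + l), resFin hq (p * kk.2 + l')) = aa),
        c kk * w ^ (p * kk.1 + l) * w' ^ (p * kk.2 + l') := by
    intro aa
    rw [Finset.sum_mul]
    refine Finset.sum_congr rfl fun kk hkk => ?_
    have hka : (resFin hq (p * kk.1 + l), resFin hq (p * kk.2 + l')) = aa := (Finset.mem_filter.1 hkk).2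
    have hav : (aa.1 : ℕ) = (p * kk.1 + l) % q := by rw [← hka]; rfl
    have hav' : (aa.2 : ℕ) = (p * kk.2 + l') % q := by rw [← hka]; rfl
    have e1 : t ^ ((p * kk.1 + l) / q) * w ^ (aa.1 : ℕ) = w ^ (p * kk.1 + l) := by
      rw [← hw, ← pow_mul, ← pow_add, hav, Nat.div_add_mod]
    have e2 : t' ^ ((p * kk.2 + l') / q) * w' ^ (aa.2 : ℕ) = w' ^ (p * kk.2 + l') := by
      rw [← hw', ← pow_mul, ← pow_add, hav', Nat.div_add_mod]
    calc c kk * t ^ ((p * kk.1 + l) / q) * t' ^ ((p * kk.2 + l') / q) * (w ^ (aa.1 : ℕ) * w' ^ (aa.2 : ℕ))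
        = c kk * (t ^ ((p * kk.1 + l) / q) * w ^ (aa.1 : ℕ)) * (t' ^ ((p * kk.2 + l') / q) * w' ^ (aa.2 : ℕ)) := by
          ring
      _ = c kk * w ^ (p * kk.1 + l) * w' ^ (p * kk.2 + l') := by rw [e1, e2]
  rw [Finset.sum_congr rfl fun aa _ => step1 aa,
    Finset.sum_fiberwise_of_maps_to (fun kk _ => Finset.mem_univ _), Finset.sum_mul]
  refine Finset.sum_congr rfl fun kk _ => ?_
  rw [pow_add, pow_add]; ring

variable (i₀ i₁ : Fin n) (q : ℕ)

/-- `powSubst i₀ q` keeps the `q`-divisibility of the `i₁`-exponents (`i₁ ≠ i₀`). -/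
theorem qdiv_powSubst_of_ne (h : i₁ ≠ i₀) {g : MvPolynomial (Fin n) ℤ} (hg : QDiv i₁ q g) :
    QDiv i₁ q (powSubst i₀ q g) := by
  classical
  intro m hm
  rw [powSubst_eq_sum] at hm
  obtain ⟨m', hm'P, hm'⟩ := Finset.mem_biUnion.1 (support_sum hm)
  have hmm : m = psi i₀ q m' := by simpa using support_monomial_subset hm'
  rw [hmm, psi_apply, if_neg h]
  exact hg m' hm'P

/-- The double power substitution `X_{i₀} ↦ X_{i₀}^q`, `X_{i₁} ↦ X_{i₁}^q`. -/
def powSubst₂ : MvPolynomial (Fin n) ℤ →ₐ[ℤ] MvPolynomial (Fin n) ℤ :=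
  (powSubst i₀ q).comp (powSubst i₁ q)

/-- `powSubst₂` on a monomial exponent (unfolding lemma). -/
theorem powSubst₂_apply (g : MvPolynomial (Fin n) ℤ) : powSubst₂ i₀ i₁ q g = powSubst i₀ q (powSubst i₁ q g) := rfl

/-- `powSubst₂ (X_{i₀}) = X_{i₀}^q` (`i₀ ≠ i₁`). -/
theorem powSubst₂_X_fst (h : i₀ ≠ i₁) : powSubst₂ i₀ i₁ q (X i₀) = X i₀ ^ q := by
  rw [powSubst₂_apply, powSubst_X, if_neg h, powSubst_X_self]

/-- `powSubst₂ (X_{i₁}) = X_{i₁}^q`. -/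
theorem powSubst₂_X_snd (h : i₀ ≠ i₁) : powSubst₂ i₀ i₁ q (X i₁) = X i₁ ^ q := by
  rw [powSubst₂_apply, powSubst_X_self, map_pow, powSubst_X, if_neg (Ne.symm h)]

/-- `powSubst₂` is injective (`q > 0`). -/
theorem powSubst₂_eq_zero_iff (hq : 0 < q) (g : MvPolynomial (Fin n) ℤ) : powSubst₂ i₀ i₁ q g = 0 ↔ g = 0 := by
  rw [powSubst₂_apply, powSubst_eq_zero_iff i₀ q hq, powSubst_eq_zero_iff i₁ q hq]

/-- Both divisibilities for `powSubst₂ g` (`i₀ ≠ i₁`). -/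
theorem qdiv_powSubst₂ (h : i₀ ≠ i₁) (g : MvPolynomial (Fin n) ℤ) :
    QDiv i₀ q (powSubst₂ i₀ i₁ q g) ∧ QDiv i₁ q (powSubst₂ i₀ i₁ q g) :=
  ⟨qdiv_powSubst i₀ q _, qdiv_powSubst_of_ne i₀ i₁ q (Ne.symm h) (qdiv_powSubst i₁ q g)⟩

/-- **Two-variable residue lemma.** A sum `Σ_k g_k · X_{i₀}^{e_k} X_{i₁}^{e'_k}` whose `g_k` have all `i₀`- and
`i₁`-exponents `≡ 0 (mod q)` and whose exponent PAIRS `(e_k, e'_k)` are pairwise distinct mod `q` vanishes only if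
every `g_k` does (`i₀ ≠ i₁`). -/
theorem residue_lemma₂ {ι : Type*} (h01 : i₀ ≠ i₁) (_hq : 0 < q) (S : Finset ι)
    (g : ι → MvPolynomial (Fin n) ℤ) (e e' : ι → ℕ)
    (hg₀ : ∀ k ∈ S, QDiv i₀ q (g k)) (hg₁ : ∀ k ∈ S, QDiv i₁ q (g k))
    (he : ∀ k ∈ S, ∀ k' ∈ S, e k % q = e k' % q → e' k % q = e' k' % q → k = k')
    (h0 : ∑ k ∈ S, g k * (X i₀ ^ e k * X i₁ ^ e' k) = 0) : ∀ k ∈ S, g k = 0 := by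
  classical
  intro k hk
  by_contra hne
  obtain ⟨m₀, hm₀⟩ := MvPolynomial.ne_zero_iff.1 hne
  have hdiv₀ : q ∣ m₀ i₀ := hg₀ k hk m₀ (mem_support_iff.2 hm₀)
  have hdiv₁ : q ∣ m₀ i₁ := hg₁ k hk m₀ (mem_support_iff.2 hm₀)
  set ex : ι → (Fin n →₀ ℕ) := fun k' => Finsupp.single i₀ (e k') + Finsupp.single i₁ (e' k') with hex
  have hex₀ : ∀ k', ex k' i₀ = e k' := fun k' => by
    simp [hex, Ne.symm h01]
  have hex₁ : ∀ k', ex k' i₁ = e' k' := fun k' => by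
    simp [hex, h01]
  have hXpow : ∀ k', (X i₀ ^ e k' * X i₁ ^ e' k' : MvPolynomial (Fin n) ℤ) = monomial (ex k') 1 := by
    intro k'
    rw [X_pow_eq_monomial, X_pow_eq_monomial, monomial_mul, mul_one]
  set m : Fin n →₀ ℕ := m₀ + ex k with hm
  have hterm : ∀ k' ∈ S, (g k' * (X i₀ ^ e k' * X i₁ ^ e' k')).coeff m =
      if k' = k then (g k).coeff m₀ else 0 := by
    intro k' hk'
    rw [hXpow, coeff_mul_monomial', mul_one]
    by_cases hkk : k' = k
    · rw [hkk, if_pos (by rw [hm]; exact le_add_self), if_pos rfl, hm, add_tsub_cancel_right]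
    · rw [if_neg hkk]
      split_ifs with hle
      · by_contra hc
        have hsupp : m - ex k' ∈ (g k').support := mem_support_iff.2 hc
        have hd₀ := hg₀ k' hk' _ hsupp
        have hd₁ := hg₁ k' hk' _ hsupp
        simp only [Finsupp.tsub_apply, hm, Finsupp.add_apply, hex₀, hex₁] at hd₀ hd₁
        have hle₀ : e k' ≤ m₀ i₀ + e k := by have := hle i₀; simpa [hm, hex₀] using this
        have hle₁ : e' k' ≤ m₀ i₁ + e' k := by have := hle i₁; simpa [hm, hex₁] using this
        apply hkk
        apply he k' hk' k hk
        · obtain ⟨d, hd⟩ := hdiv₀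
          obtain ⟨u, hu⟩ := hd₀
          have h1 : m₀ i₀ + e k = q * u + e k' := by omega
          have hA : (m₀ i₀ + e k) % q = e k % q := by rw [hd, Nat.mul_add_mod]
          have hB : (m₀ i₀ + e k) % q = e k' % q := by rw [h1, Nat.mul_add_mod]
          exact hB.symm.trans hA
        · obtain ⟨d, hd⟩ := hdiv₁
          obtain ⟨u, hu⟩ := hd₁
          have h1 : m₀ i₁ + e' k = q * u + e' k' := by omega
          have hA : (m₀ i₁ + e' k) % q = e' k % q := by rw [hd, Nat.mul_add_mod]
          have hB : (m₀ i₁ + e' k) % q = e' k' % q := by rw [h1, Nat.mul_add_mod]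
          exact hB.symm.trans hA
      · rfl
  have hsum : (∑ k' ∈ S, g k' * (X i₀ ^ e k' * X i₁ ^ e' k')).coeff m = (g k).coeff m₀ := by
    rw [coeff_sum, Finset.sum_congr rfl hterm, Finset.sum_ite_eq' S k, if_pos hk]
  rw [h0, coeff_zero] at hsum
  exact hm₀ hsum.symm

/-- **The two-radical norm-form matrix.** Row `(l,l')`, column `(a,a')`:
`Σ_{k,k' ≤ K, (pk+l) % q = a, (pk'+l') % q = a'} C_{kk'} · X_{i₀}^{(pk+l)/q} X_{i₁}^{(pk'+l')/q}` — the matrix of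
multiplication by `Σ_{k,k'} C_{kk'} T^{pk} S^{pk'}` on `ℤ[X][T,S]/(T^q − X_{i₀}, S^q − X_{i₁})` in the basis `T^l S^{l'}`. -/
def radMat₂ (Cf : ℕ × ℕ → MvPolynomial (Fin n) ℤ) (K p : ℕ) {q : ℕ} (hq : 0 < q) (i₀ i₁ : Fin n) :
    Matrix (Fin q × Fin q) (Fin q × Fin q) (MvPolynomial (Fin n) ℤ) :=
  fun ll aa => ∑ kk ∈ (Finset.range (K + 1) ×ˢ Finset.range (K + 1)).filter
      (fun kk => (resFin hq (p * kk.1 + ll.1), resFin hq (p * kk.2 + ll.2)) = aa),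
    Cf kk * X i₀ ^ ((p * kk.1 + ll.1) / q) * X i₁ ^ ((p * kk.2 + ll.2) / q)

/-- `powSubst₂` applied to an entry of `radMat₂`. -/
theorem powSubst₂_radMat₂ (h : i₀ ≠ i₁) (Cf : ℕ × ℕ → MvPolynomial (Fin n) ℤ) (K p : ℕ) (hq : 0 < q)
    (ll aa : Fin q × Fin q) :
    powSubst₂ i₀ i₁ q (radMat₂ Cf K p hq i₀ i₁ ll aa) =
      ∑ kk ∈ (Finset.range (K + 1) ×ˢ Finset.range (K + 1)).filter
          (fun kk => (resFin hq (p * kk.1 + ll.1), resFin hq (p * kk.2 + ll.2)) = aa),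
        powSubst₂ i₀ i₁ q (Cf kk) * (X i₀ ^ q) ^ ((p * kk.1 + ll.1) / q) * (X i₁ ^ q) ^ ((p * kk.2 + ll.2) / q) := by
  simp only [radMat₂, map_sum, map_mul, map_pow, powSubst₂_X_fst i₀ i₁ q h, powSubst₂_X_snd i₀ i₁ q h]

/-- **Formal non-vanishing of the two-radical norm form.** For `i₀ ≠ i₁`, `K < q`, `gcd(p,q) = 1` and some
`C_{kk'} ≠ 0` (`k, k' ≤ K`): `det (radMat₂) ≠ 0` in `ℤ[X]`. A kernel vector `v` would give
`(Σ_{l,l'} φ(v_{ll'}) X_{i₀}^l X_{i₁}^{l'}) · (Σ_{k,k'} φ(C_{kk'}) X_{i₀}^{pk} X_{i₁}^{pk'}) = 0` under the double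
substitution `φ = powSubst₂`, and the two-variable residue lemma kills both factors' coefficients. -/
theorem det_radMat₂_ne_zero (h : i₀ ≠ i₁) (Cf : ℕ × ℕ → MvPolynomial (Fin n) ℤ) {K p : ℕ} (hq : 0 < q)
    (hKq : K < q) (hpq : Nat.Coprime p q) (hC : ∃ kk ∈ Finset.range (K + 1) ×ˢ Finset.range (K + 1), Cf kk ≠ 0) :
    (radMat₂ Cf K p hq i₀ i₁).det ≠ 0 := by
  classical
  rw [Ne, ← Matrix.exists_vecMul_eq_zero_iff]
  rintro ⟨v, hv0, hv⟩
  apply hv0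
  set Ψ : MvPolynomial (Fin n) ℤ := ∑ kk ∈ Finset.range (K + 1) ×ˢ Finset.range (K + 1),
    powSubst₂ i₀ i₁ q (Cf kk) * (X i₀ ^ (p * kk.1) * X i₁ ^ (p * kk.2)) with hΨ
  set V : MvPolynomial (Fin n) ℤ := ∑ ll : Fin q × Fin q,
    powSubst₂ i₀ i₁ q (v ll) * (X i₀ ^ (ll.1 : ℕ) * X i₁ ^ (ll.2 : ℕ)) with hV
  have hrow : ∀ ll : Fin q × Fin q,
      ∑ aa : Fin q × Fin q, powSubst₂ i₀ i₁ q (radMat₂ Cf K p hq i₀ i₁ ll aa) * (X i₀ ^ (aa.1 : ℕ) * X i₁ ^ (aa.2 : ℕ)) =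
        Ψ * (X i₀ ^ (ll.1 : ℕ) * X i₁ ^ (ll.2 : ℕ)) := by
    intro ll
    simp_rw [powSubst₂_radMat₂ i₀ i₁ q h]
    exact fiber_sum₂ hq K p (fun kk => powSubst₂ i₀ i₁ q (Cf kk)) (X i₀ ^ q) (X i₁ ^ q) (X i₀) (X i₁)
      rfl rfl ll.1 ll.2
  have h1 : ∀ aa : Fin q × Fin q, powSubst₂ i₀ i₁ q ((Matrix.vecMul v (radMat₂ Cf K p hq i₀ i₁)) aa) = 0 :=
    fun aa => by rw [hv]; simp
  have hVΨ : V * Ψ = 0 := by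
    calc V * Ψ = ∑ ll : Fin q × Fin q, powSubst₂ i₀ i₁ q (v ll) * (Ψ * (X i₀ ^ (ll.1 : ℕ) * X i₁ ^ (ll.2 : ℕ))) := by
          rw [hV, Finset.sum_mul]
          exact Finset.sum_congr rfl fun ll _ => by ring
      _ = ∑ ll : Fin q × Fin q, powSubst₂ i₀ i₁ q (v ll) *
            ∑ aa : Fin q × Fin q, powSubst₂ i₀ i₁ q (radMat₂ Cf K p hq i₀ i₁ ll aa) *
              (X i₀ ^ (aa.1 : ℕ) * X i₁ ^ (aa.2 : ℕ)) := by
          simp_rw [hrow]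
      _ = ∑ aa : Fin q × Fin q, powSubst₂ i₀ i₁ q ((Matrix.vecMul v (radMat₂ Cf K p hq i₀ i₁)) aa) *
            (X i₀ ^ (aa.1 : ℕ) * X i₁ ^ (aa.2 : ℕ)) := by
          simp only [Matrix.vecMul, dotProduct, map_sum, map_mul, Finset.mul_sum, Finset.sum_mul]
          rw [Finset.sum_comm]
          exact Finset.sum_congr rfl fun aa _ => Finset.sum_congr rfl fun ll _ => by ring
      _ = 0 := by simp [h1]
  have hΨ0 : Ψ ≠ 0 := by
    intro hΨz
    obtain ⟨kk₀, hkk₀, hCk₀⟩ := hC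
    have hres := residue_lemma₂ i₀ i₁ q h hq (Finset.range (K + 1) ×ˢ Finset.range (K + 1))
      (fun kk => powSubst₂ i₀ i₁ q (Cf kk)) (fun kk => p * kk.1) (fun kk => p * kk.2)
      (fun kk _ => (qdiv_powSubst₂ i₀ i₁ q h (Cf kk)).1) (fun kk _ => (qdiv_powSubst₂ i₀ i₁ q h (Cf kk)).2)
      ?_ hΨz kk₀ hkk₀
    · exact hCk₀ ((powSubst₂_eq_zero_iff i₀ i₁ q hq _).1 hres)
    · intro kk hkk kk' hkk' h₁ h₂
      have hk1 : kk.1 < q := lt_of_lt_of_le (Finset.mem_range.1 (Finset.mem_product.1 hkk).1) hKq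
      have hk2 : kk.2 < q := lt_of_lt_of_le (Finset.mem_range.1 (Finset.mem_product.1 hkk).2) hKq
      have hk1' : kk'.1 < q := lt_of_lt_of_le (Finset.mem_range.1 (Finset.mem_product.1 hkk').1) hKq
      have hk2' : kk'.2 < q := lt_of_lt_of_le (Finset.mem_range.1 (Finset.mem_product.1 hkk').2) hKq
      have hm1 : p * kk.1 ≡ p * kk'.1 [MOD q] := h₁
      have hm2 : p * kk.2 ≡ p * kk'.2 [MOD q] := h₂
      exact Prod.ext (Nat.ModEq.eq_of_lt_of_lt (Nat.ModEq.cancel_left_of_coprime hpq.symm hm1) hk1 hk1')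
        (Nat.ModEq.eq_of_lt_of_lt (Nat.ModEq.cancel_left_of_coprime hpq.symm hm2) hk2 hk2')
  have hV0 : V = 0 := (mul_eq_zero.1 hVΨ).resolve_right hΨ0
  have hres := residue_lemma₂ i₀ i₁ q h hq (Finset.univ : Finset (Fin q × Fin q))
    (fun ll => powSubst₂ i₀ i₁ q (v ll)) (fun ll => (ll.1 : ℕ)) (fun ll => (ll.2 : ℕ))
    (fun ll _ => (qdiv_powSubst₂ i₀ i₁ q h (v ll)).1) (fun ll _ => (qdiv_powSubst₂ i₀ i₁ q h (v ll)).2) ?_ hV0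
  · funext ll
    exact (powSubst₂_eq_zero_iff i₀ i₁ q hq _).1 (hres ll (Finset.mem_univ ll))
  · intro ll _ ll' _ h₁ h₂
    rw [Nat.mod_eq_of_lt ll.1.isLt, Nat.mod_eq_of_lt ll'.1.isLt] at h₁
    rw [Nat.mod_eq_of_lt ll.2.isLt, Nat.mod_eq_of_lt ll'.2.isLt] at h₂
    exact Prod.ext (Fin.ext h₁) (Fin.ext h₂)

/-- **Norm factorisation (evaluated, reindexed).** If `w^q = t`, `w'^q = t'` and `Mθ` is the evaluated
two-radical norm-form matrix transported to `Fin (q·q)` along `e`, then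
`det Mθ = (Σ_{k,k'} c_{kk'} w^{pk} w'^{pk'}) · Σ_c adj(Mθ)_{e(0,0), c} · w^{a(c)} w'^{a'(c)}`
(adjugate identity on the eigenvector `(w^a w'^{a'})`). -/
theorem det_eq_eigen_mul₂ {q : ℕ} (hq : 0 < q) (K p : ℕ) (c : ℕ × ℕ → ℂ) (t t' w w' : ℂ)
    (hw : w ^ q = t) (hw' : w' ^ q = t') (e : Fin q × Fin q ≃ Fin (q * q))
    (Mθ : Matrix (Fin (q * q)) (Fin (q * q)) ℂ)
    (hM : ∀ r s, Mθ r s = ∑ kk ∈ (Finset.range (K + 1) ×ˢ Finset.range (K + 1)).filter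
        (fun kk => (resFin hq (p * kk.1 + (e.symm r).1), resFin hq (p * kk.2 + (e.symm r).2)) = e.symm s),
      c kk * t ^ ((p * kk.1 + (e.symm r).1) / q) * t' ^ ((p * kk.2 + (e.symm r).2) / q)) :
    Mθ.det = (∑ kk ∈ Finset.range (K + 1) ×ˢ Finset.range (K + 1), c kk * (w ^ (p * kk.1) * w' ^ (p * kk.2))) *
      ∑ s : Fin (q * q), Mθ.adjugate (e (⟨0, hq⟩, ⟨0, hq⟩)) s * (w ^ ((e.symm s).1 : ℕ) * w' ^ ((e.symm s).2 : ℕ)) := by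
  classical
  set vw : Fin (q * q) → ℂ := fun s => w ^ ((e.symm s).1 : ℕ) * w' ^ ((e.symm s).2 : ℕ) with hvw
  set Φ : ℂ := ∑ kk ∈ Finset.range (K + 1) ×ˢ Finset.range (K + 1), c kk * (w ^ (p * kk.1) * w' ^ (p * kk.2))
    with hΦ
  have heig : Mθ.mulVec vw = Φ • vw := by
    funext r
    simp only [Matrix.mulVec, dotProduct, Pi.smul_apply, smul_eq_mul, hvw]
    rw [Finset.sum_congr rfl fun s _ => by rw [hM r s]]
    have key := fiber_sum₂ hq K p c t t' w w' hw hw' (e.symm r).1 (e.symm r).2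
    rw [← e.symm.sum_comp] at key
    · simpa using key
  have h2 : Mθ.adjugate.mulVec (Mθ.mulVec vw) = Mθ.det • vw := by
    rw [Matrix.mulVec_mulVec, Matrix.adjugate_mul, Matrix.smul_mulVec, Matrix.one_mulVec]
  have h3 : Mθ.det • vw = Φ • (Mθ.adjugate.mulVec vw) := by
    rw [← h2, heig, Matrix.mulVec_smul]
  have h4 := congrFun h3 (e (⟨0, hq⟩, ⟨0, hq⟩))
  simp only [Pi.smul_apply, smul_eq_mul, Matrix.mulVec, dotProduct, hvw, Equiv.symm_apply_apply, pow_zero,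
    mul_one] at h4
  rw [h4]

end Formal

end Summit.Schanuel.Schanuel.Theorems.RootDecomp1BTwoRadical

end
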